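import Summits.BirchSwinnertonDyer.BirchSwinnertonDyer.Theorems.PrintCFramBottomClassIndexLawFiveLeCuspSeedCohenTLSeries
import Summits.BirchSwinnertonDyer.BirchSwinnertonDyer.Theorems.PrintCFramBottomClassIndexLawFiveLeCuspSeedCutUnfolding
import Summits.BirchSwinnertonDyer.BirchSwinnertonDyer.Theorems.PrintCFramBottomClassIndexLawFiveLeCohenCutKronecker
import Literature.NumberTheory.ModularForms.CohenEisensteinLValueKronecker
import Mathlib.NumberTheory.LSeries.DirichletContinuation
import Mathlib.Analysis.Normed.Ring.InfiniteSum
import HarnessLib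

set_option autoImplicit false

/-!
# Crux `PrintCFram.BottomClassIndexLawFiveLe` (stmt-BirchSwinnertonDyer-20372), line `eisenstein-resource-bdp-line` (registry v24/v25):
# (E3) OF THE CUSP-CONJUNCT ASSEMBLY, ANALYTIC PART 1 — THE `N`-TH SUMMAND OF THE UNFOLDED CUT COHEN `L`-SERIES
# (cell `bsd-print-cfram`, width seat `bsd-line-cfram-p1-w5` g6; THEOREMS ONLY, `--supports` 20372; BSD is not proved by any of this)

HONEST FRAMING. Raw-`LSeries` bookkeeping; nothing modular beyond citing Cohen's numbers. Ingredient of (E3) of the proof plan for the cusp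
conjunct «`G = 0 ⟹ ι C = 0`» of the registered stub `stub_cuspCutForm` (crux notes `Lines/eisenstein-resource-bdp-line-w5g5-cusp-seed.md`
§§3–5): after the unfolding (E2, `CuspSeed.LSeries_ite_cut_cohenH_eq`) the cut series is `Σ_{N ∈ F} L(1−k,χ_D)·(mN)^{−s}·L(𝟙_{⊥6m}T_D, 2s)`,
`D = e·(−N)`, for EVERY fundamental discriminant `e` (or `e = 1`), `m = |e|` — odd AND even `m`, thanks to w4 g13's (C) for every
fundamental discriminant (`CohenEisenstein.algebraMap_lValueDisc_eq_LSeries_chiDisc`, p697354). THIS FILE rewrites the `N`-th summand: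

* `ratCast_lValueDisc_eq_mul_LSeries` — (C) through `Rat.cast`: `L(1−k,χ_D) = c_k |D|^{k−1}√|D| π^{−k} · Σ_a χ_D(a)a^{−k}`,
  `c_k = (−1)^{⌊k/2⌋}(k−1)!/2^{k−1}`;
* `LSeries_chiDisc_mul_LSeries_moebius_eq_tsum` — `L(k,χ_D)·L(𝟙_{⊥M}μχ_D id^{k−1}, u) = Σ_{(a,b)} χ_e(a)a^{−k}·𝟙μχ_e(b)b^{−(u−k+1)}·J(ab|N)`
  (`χ_D = χ_e·J(·|N)`, w4 g12 `CohenCut.chiDisc_mul_jacobiSym`);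
* **`lValueDisc_mul_cpow_mul_LSeries_cohenT_eq`** — with LEMMA B (E1, `CuspSeed.LSeries_ite_coprime_cohenT`):
  `L(1−k,χ_D)(mN)^{−s}L(𝟙_{⊥6m}T_D,2s) = [c_k π^{−k} L(𝟙_{⊥6m},2s) L(𝟙_{⊥6m}id^{2k−1},2s)]·(mN)^{−(s−k+1/2)}·Σ_{(a,b)} χ_e(a)a^{−k}·
  𝟙_{b⊥6m}μ(b)χ_e(b)b^{−(2s−k+1)}·J(ab|N)`.

[cite: Cohen1975, §2] for the numbers; the rest [folklore]. References: [Cohen1975] §2; [MontgomeryVaughan2007] §9.3.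
-/

-- summit-side namespace `Summit.BirchSwinnertonDyer.BirchSwinnertonDyer.…` (single-conjunct summit, D-0017 layout)
set_option linter.dupNamespace false

namespace Summit.BirchSwinnertonDyer.BirchSwinnertonDyer.Theorems.PrintCFram.CuspSeed

open LSeries ArithmeticFunction Literature.NumberTheory.ModularForms.CohenEisenstein
  Literature.NumberTheory.QuadraticFields
open scoped LSeries.notation ArithmeticFunction.Moebius NumberTheorySymbols Classical

/-! ## §1 `L(1 − k, χ_D)` through the convergent series `L(k, χ_D) = Σ χ_D(a) a^{−k}` -/

/-- **(C) in raw-`LSeries` currency, every fundamental discriminant.** For `D` a fundamental discriminant or `1` and `k ≥ 2` of the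
parity of `χ_D`: `L(1−k, χ_D) = (−1)^{⌊k/2⌋}(k−1)!/2^{k−1} · |D|^{k−1} √|D| / π^k · Σ_a χ_D(a) a^{−k}` — w4 g13's
`CohenEisenstein.algebraMap_lValueDisc_eq_LSeries_chiDisc` (p697354; odd `D`: w5 g5 p692672) read through `Rat.cast`.
[cite: Cohen1975, §2 (definition of h(r,N) and of H(r,N))] -/
theorem ratCast_lValueDisc_eq_mul_LSeries {D : ℤ}
    (hD : D = 1 ∨ (D % 4 = 1 ∧ Squarefree D ∧ D ≠ 1) ∨ (4 ∣ D ∧ (D / 4 % 4 = 2 ∨ D / 4 % 4 = 3) ∧ Squarefree (D / 4)))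
    {k : ℕ} (hk : 2 ≤ k) (hpar : (0 < D ∧ Even k) ∨ (D < 0 ∧ Odd k)) :
    (lValueDisc k D : ℂ) = (-1 : ℂ) ^ (k / 2) * ((k - 1).factorial : ℂ) / 2 ^ (k - 1) * (D.natAbs : ℂ) ^ (k - 1) *
        (Real.sqrt D.natAbs : ℂ) / (Real.pi : ℂ) ^ k * LSeries (fun a : ℕ ↦ (chiDisc D a : ℂ)) k := by
  have h := algebraMap_lValueDisc_eq_LSeries_chiDisc hD hk hpar
  rwa [eq_ratCast] at h

/-! ## §2 The product `L(k, χ_D) · L(𝟙_{⊥M} μ χ_D id^{k−1}, u)` as a double series with the Jacobi symbol split off -/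

/-- For `D = e·(−N)` (`e ≡ 1 (4)` or `4 ∣ e`, `e ≠ 0`, `N ≡ 3 (4)`), `k ≥ 2` and `Re u > k`:
`L(k, χ_D) · L(𝟙_{⊥M} μ χ_D id^{k−1}, u) = Σ_{(a,b)} [χ_e(a) a^{−k}] · [𝟙_{b⊥M} μ(b) χ_e(b) b^{−(u−k+1)}] · J(ab | N)`
(absolutely convergent double series; `χ_D = χ_e · J(·|N)` by w4 g12 `CohenCut.chiDisc_mul_jacobiSym`). [folklore] -/
theorem LSeries_chiDisc_mul_LSeries_moebius_eq_tsum {e : ℤ} (he : e % 4 = 1 ∨ 4 ∣ e) (he0 : e ≠ 0) {N : ℕ} (hN4 : N % 4 = 3)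
    (M : ℕ) {k : ℕ} (hk : 2 ≤ k) {u : ℂ} (hu : (k : ℝ) < u.re) :
    LSeries (fun a : ℕ ↦ (chiDisc (e * -(N : ℤ)) a : ℂ)) k *
        LSeries (fun b : ℕ ↦ if b.Coprime M then (μ b : ℂ) * (chiDisc (e * -(N : ℤ)) b : ℂ) * (b : ℂ) ^ (k - 1) else 0) u =
      ∑' x : ℕ × ℕ, term (fun a : ℕ ↦ (chiDisc e a : ℂ)) k x.1 *
        term (fun b : ℕ ↦ if b.Coprime M then (μ b : ℂ) * (chiDisc e b : ℂ) else 0) (u - k + 1) x.2 *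
        (J(((x.1 * x.2 : ℕ) : ℤ) | N) : ℂ) := by
  have hk1 : 1 ≤ k := by omega
  have hA : LSeriesSummable (fun a : ℕ ↦ (chiDisc (e * -(N : ℤ)) a : ℂ)) k := by
    refine LSeriesSummable_of_le_const_mul_rpow (x := 1) (by simp only [Complex.natCast_re]; exact_mod_cast hk)
      ⟨1, fun n _ ↦ ?_⟩
    rw [sub_self, Real.rpow_zero, mul_one]
    rcases chiDisc_trichotomy (e * -(N : ℤ)) n with h | h | h <;> rw [h] <;> simp
  have hB := LSeriesSummable_ite_coprime_moebius_chiDisc_pow hk1 (e * -(N : ℤ)) M hu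
  rw [LSeries, LSeries, tsum_mul_tsum_of_summable_norm hA.norm hB.norm]
  refine tsum_congr fun x ↦ ?_
  obtain ⟨a, b⟩ := x
  simp only
  rcases eq_or_ne a 0 with rfl | ha
  · simp
  rcases eq_or_ne b 0 with rfl | hb
  · simp
  have hbc : (b : ℂ) ≠ 0 := Nat.cast_ne_zero.mpr hb
  rw [term_of_ne_zero ha, term_of_ne_zero hb, term_of_ne_zero ha, term_of_ne_zero hb,
    ← CohenCut.chiDisc_mul_jacobiSym he he0 hN4 a, ← CohenCut.chiDisc_mul_jacobiSym he he0 hN4 b]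
  push_cast
  rw [jacobiSym.mul_left]
  -- `b^{k-1} / b^u = 1 / b^{u-k+1}`
  have hpow : (b : ℂ) ^ (u - k + 1) = (b : ℂ) ^ u / (b : ℂ) ^ (k - 1 : ℕ) := by
    rw [← Complex.cpow_natCast, ← Complex.cpow_sub _ _ hbc, Nat.cast_sub hk1]
    push_cast
    ring_nf
  rw [hpow]
  have hbk : (b : ℂ) ^ (k - 1 : ℕ) ≠ 0 := pow_ne_zero _ hbc
  have hbu : (b : ℂ) ^ u ≠ 0 := by rw [Ne, Complex.cpow_eq_zero_iff, not_and_or]; exact Or.inl hbc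
  split_ifs with hcop
  · push_cast
    field_simp
  · simp

/-! ## §3 The `N`-th summand of the unfolded cut series -/

/-- Power bookkeeping: for a natural `X ≥ 1`, `X^{k−1} · √X · X^{−s} = X^{−(s − k + 1/2)}` as complex powers. [folklore] -/
theorem natCast_pow_mul_sqrt_mul_cpow_neg {X : ℕ} (hX : X ≠ 0) {k : ℕ} (hk : 1 ≤ k) (s : ℂ) :
    (X : ℂ) ^ (k - 1) * (Real.sqrt X : ℂ) * (X : ℂ) ^ (-s) = (X : ℂ) ^ (-(s - k + 1 / 2)) := by
  have hXc : (X : ℂ) ≠ 0 := Nat.cast_ne_zero.mpr hX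
  have hsqrt : (Real.sqrt X : ℂ) = (X : ℂ) ^ ((1 / 2 : ℂ)) := by
    rw [Real.sqrt_eq_rpow, Complex.ofReal_cpow (Nat.cast_nonneg X)]
    push_cast
    rfl
  rw [hsqrt, ← Complex.cpow_natCast, ← Complex.cpow_add _ _ hXc, ← Complex.cpow_add _ _ hXc]
  congr 1
  push_cast [Nat.cast_sub hk]
  ring

/-- **THE `N`-TH SUMMAND.** For `e` a fundamental discriminant or `1` (`m = |e|`), parity `(−1)^k m = −e`, `k ≥ 2`,
`N` squarefree with `N ≡ 3 (mod 4)` and `J(−N|q) = 1` for the odd primes `q ∣ m`, and `Re s > k`: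
`L(1−k, χ_{e·(−N)}) · (mN)^{−s} · L(𝟙_{⊥6m} T_k(e·(−N), ·), 2s)
  = [c_k π^{−k} · L(𝟙_{⊥6m}, 2s) · L(𝟙_{⊥6m} id^{2k−1}, 2s)] · (mN)^{−(s − k + 1/2)} · Σ_{(a,b)} χ_e(a)a^{−k} · 𝟙_{b⊥6m}μ(b)χ_e(b) b^{−(2s−k+1)} · J(ab|N)`
((C) w5 g5 p692672 + LEMMA B `LSeries_ite_coprime_cohenT` + `LSeries_chiDisc_mul_LSeries_moebius_eq_tsum`).
[cite: Cohen1975, §2 (definition of h(r,N) and of H(r,N))] -/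
theorem lValueDisc_mul_cpow_mul_LSeries_cohenT_eq {e : ℤ}
    (he : e = 1 ∨ (e % 4 = 1 ∧ Squarefree e ∧ e ≠ 1) ∨ (4 ∣ e ∧ (e / 4 % 4 = 2 ∨ e / 4 % 4 = 3) ∧ Squarefree (e / 4)))
    {m : ℕ} (hme : e.natAbs = m) {k : ℕ} (hk : 2 ≤ k)
    (hsign : (-1 : ℤ) ^ k * m = -e) {N : ℕ} (hN : Squarefree N) (hN4 : N % 4 = 3)
    (hJ : ∀ q : ℕ, q.Prime → q ∣ m → q ≠ 2 → J(-(N : ℤ) | q) = 1) {s : ℂ} (hs : (k : ℝ) < s.re) :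
    (lValueDisc k (e * -(N : ℤ)) : ℂ) * ((m : ℂ) * (N : ℂ)) ^ (-s) *
        LSeries (fun f : ℕ ↦ if f.Coprime (6 * m) then (cohenT k (e * -(N : ℤ)) f : ℂ) else 0) (2 * s) =
      ((-1 : ℂ) ^ (k / 2) * ((k - 1).factorial : ℂ) / 2 ^ (k - 1) / (Real.pi : ℂ) ^ k *
          (LSeries (fun a : ℕ ↦ if a.Coprime (6 * m) then (1 : ℂ) else 0) (2 * s) *
            LSeries (fun b : ℕ ↦ if b.Coprime (6 * m) then (b : ℂ) ^ (2 * k - 1) else 0) (2 * s))) *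
        ((m : ℂ) * (N : ℂ)) ^ (-(s - k + 1 / 2)) *
        ∑' x : ℕ × ℕ, term (fun a : ℕ ↦ (chiDisc e a : ℂ)) k x.1 *
          term (fun b : ℕ ↦ if b.Coprime (6 * m) then (μ b : ℂ) * (chiDisc e b : ℂ) else 0) (2 * s - k + 1) x.2 *
          (J(((x.1 * x.2 : ℕ) : ℤ) | N) : ℂ) := by
  have hk1 : 1 ≤ k := by omega
  have he4 : e % 4 = 1 ∨ 4 ∣ e := by
    rcases he with rfl | ⟨h, -, -⟩ | ⟨h, -, -⟩
    · exact Or.inl (by decide)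
    · exact Or.inl h
    · exact Or.inr h
  have he0 : e ≠ 0 := by
    rintro rfl
    rcases he with h | ⟨h, -, -⟩ | ⟨-, h, -⟩ <;> norm_num at h
  have hm0 : m ≠ 0 := by rw [← hme]; exact Int.natAbs_ne_zero.mpr he0
  have hN0 : N ≠ 0 := by rintro rfl; norm_num at hN4
  -- `D = e·(−N)` is a fundamental discriminant with `|D| = m N`
  have hDabs : (e * -(N : ℤ)).natAbs = m * N := by
    rw [Int.natAbs_mul, Int.natAbs_neg, Int.natAbs_natCast, hme]
  have hcop : m.Coprime N := coprime_of_family hN4 hJ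
  have hDf := CohenCut.isFundamental_mul_neg he hN4 hN (hme ▸ hcop)
  have hpar : (0 < e * -(N : ℤ) ∧ Even k) ∨ (e * -(N : ℤ) < 0 ∧ Odd k) := by
    have hNpos : (0 : ℤ) < N := by exact_mod_cast Nat.pos_of_ne_zero hN0
    have hmpos : (0 : ℤ) < m := by exact_mod_cast Nat.pos_of_ne_zero hm0
    have habs : (m : ℤ) = |e| := by rw [← hme]; exact Int.natCast_natAbs e
    rcases Nat.even_or_odd k with hke | hko
    · left
      refine ⟨?_, hke⟩
      rw [hke.neg_one_pow, one_mul] at hsign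
      nlinarith
    · right
      refine ⟨?_, hko⟩
      rw [hko.neg_one_pow] at hsign
      nlinarith
  rw [ratCast_lValueDisc_eq_mul_LSeries (Or.inr hDf) hk hpar, hDabs,
    LSeries_ite_coprime_cohenT hk1 (e * -(N : ℤ)) (6 * m) (s := 2 * s)
      (by simp only [Complex.mul_re, Complex.re_ofNat, Complex.im_ofNat, zero_mul, sub_zero]; linarith)]
  have h2 := LSeries_chiDisc_mul_LSeries_moebius_eq_tsum he4 he0 hN4 (6 * m) hk (u := 2 * s)
    (by simp only [Complex.mul_re, Complex.re_ofNat, Complex.im_ofNat, zero_mul, sub_zero]; linarith)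
  have hpow := natCast_pow_mul_sqrt_mul_cpow_neg (mul_ne_zero hm0 hN0) hk1 s
  rw [show ((m * N : ℕ) : ℂ) = (m : ℂ) * (N : ℂ) from Nat.cast_mul m N] at hpow
  -- rearrange and substitute
  calc _ = ((-1 : ℂ) ^ (k / 2) * ((k - 1).factorial : ℂ) / 2 ^ (k - 1) / (Real.pi : ℂ) ^ k *
          (LSeries (fun a : ℕ ↦ if a.Coprime (6 * m) then (1 : ℂ) else 0) (2 * s) *
            LSeries (fun b : ℕ ↦ if b.Coprime (6 * m) then (b : ℂ) ^ (2 * k - 1) else 0) (2 * s))) *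
        (((m : ℂ) * (N : ℂ)) ^ (k - 1) * (Real.sqrt ((m : ℕ) * (N : ℕ) : ℕ) : ℂ) * ((m : ℂ) * (N : ℂ)) ^ (-s)) *
        (LSeries (fun a : ℕ ↦ (chiDisc (e * -(N : ℤ)) a : ℂ)) k *
          LSeries (fun b : ℕ ↦ if b.Coprime (6 * m) then (μ b : ℂ) * (chiDisc (e * -(N : ℤ)) b : ℂ) * (b : ℂ) ^ (k - 1)
            else 0) (2 * s)) := by
        push_cast
        ring
    _ = _ := by rw [h2, hpow]



end Summit.BirchSwinnertonDyer.BirchSwinnertonDyer.Theorems.PrintCFram.CuspSeed
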